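import Literature.Geometry.Riemannian.SurgicalRicciFlow
import Literature.Topology.FourManifolds.ShellCapExtension
import HarnessLib

/-!
# The pieces of a surgery step: components, ball pieces and their boundary spheres

Topological book-keeping for the deduction of Hamilton's Cor. 1.2(a)
(`Literature.Geometry.Riemannian.hamilton_chen_tang_zhu`) from Chen–Zhu's Theorem 1.1
(`Literature.Geometry.Riemannian.chenZhu_ricciFlowWithSurgery`, `SurgicalRicciFlow.lean`), whose
surgery step `IsSurgeryStep` describes `M_k ∖ N_k` and `M_{k+1} ∖ N_k'` through the finite sets
`componentsOf N_kᶜ`, `componentsOf N_k'ᶜ` of connected components and the collared pieces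
`IsNeckPiece` / `IsBallPiece` / `IsProjectiveCapPiece` (Chen–Zhu 2006, Thm. 1.1 (iii), in the
collared reading of `SurgicalRicciFlow.lean`). Everything here is elementary point-set topology:

* `componentsOf`: members are nonempty, preconnected, pairwise disjoint-or-equal, open when the
  ambient set is open (manifolds are locally connected); removing one component `C` of `Nᶜ` by
  enlarging `N` to `N ∪ C` keeps `N ∪ C` closed and leaves exactly the other components
  (`componentsOf_compl_union_eq`).
* Ball pieces (`IsBallPiece N C` with `C ∈ componentsOf Nᶜ`, witnessed by a collar
  `ι : ℝ⁴ ↪ M` with `ι(𝔹⁴) = C`, `ι(ℝ⁴ ∖ 𝔹⁴) ⊆ N`): `ι x ∈ N ↔ 1 ≤ ‖x‖`, `range ι ∩ Nᶜ = C`,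
  `closure C = ι(𝔻⁴)`, the **boundary sphere** `closure C ∖ C = ι(S³)` (independent of the
  witness), `ι({1 < ‖x‖}) ⊆ interior N`, and distinct ball pieces have disjoint closures' rims
  (`IsBallPiece.eq_of_mem_closure`).
* The shell `{a < ‖x‖ < b}` of `ℝ⁴` is connected (`isConnected_shell`), so a collar maps a thin
  shell around its sphere into a single component of the complement of `N'` under any continuous
  map avoiding `N'` (`exists_mem_componentsOf_image_shell_subset`).

## References

* B.-L. Chen, X.-P. Zhu, *Ricci flow with surgery on four-manifolds with positive isotropic
  curvature*, J. Differential Geom. 74 (2006) 177–264, Thm. 1.1 (iii) (arXiv p. 3). [ChenZhu2006]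
* R. S. Hamilton, *Four-manifolds with positive isotropic curvature*, Comm. Anal. Geom. 5 (1997),
  §1.1 pp. 3–4. [Hamilton1997]
-/

noncomputable section

open Set Function Metric TopologicalSpace
open scoped Manifold ContDiff Topology

namespace Literature.Geometry.Riemannian

/-! ### Components of a subset -/

section Components

variable {M : Type*} [TopologicalSpace M]

omit [TopologicalSpace M] in
/-- Membership in `componentsOf U`. [folklore] -/
theorem mem_componentsOf_iff [TopologicalSpace M] {U C : Set M} :
    C ∈ componentsOf U ↔ ∃ x ∈ U, connectedComponentIn U x = C := by
  simp [componentsOf]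

/-- A component of `U` is contained in `U`. [folklore] -/
theorem subset_of_mem_componentsOf {U C : Set M} (hC : C ∈ componentsOf U) : C ⊆ U := by
  obtain ⟨x, -, rfl⟩ := mem_componentsOf_iff.1 hC
  exact connectedComponentIn_subset U x

/-- A component of `U` is nonempty. [folklore] -/
theorem nonempty_of_mem_componentsOf {U C : Set M} (hC : C ∈ componentsOf U) : C.Nonempty := by
  obtain ⟨x, hx, rfl⟩ := mem_componentsOf_iff.1 hC
  exact ⟨x, mem_connectedComponentIn hx⟩

/-- A component of `U` is preconnected. [folklore] -/
theorem isPreconnected_of_mem_componentsOf {U C : Set M} (hC : C ∈ componentsOf U) :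
    IsPreconnected C := by
  obtain ⟨x, -, rfl⟩ := mem_componentsOf_iff.1 hC
  exact isPreconnected_connectedComponentIn

/-- A component of `U` is connected. [folklore] -/
theorem isConnected_of_mem_componentsOf {U C : Set M} (hC : C ∈ componentsOf U) :
    IsConnected C :=
  ⟨nonempty_of_mem_componentsOf hC, isPreconnected_of_mem_componentsOf hC⟩

/-- A component of `U` is the component of each of its points. [folklore] -/
theorem eq_connectedComponentIn_of_mem {U C : Set M} (hC : C ∈ componentsOf U) {y : M}
    (hy : y ∈ C) : C = connectedComponentIn U y := by
  obtain ⟨x, -, rfl⟩ := mem_componentsOf_iff.1 hC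
  exact connectedComponentIn_eq hy

/-- Two components of `U` which meet are equal. [folklore] -/
theorem eq_of_mem_componentsOf_of_mem {U C C' : Set M} (hC : C ∈ componentsOf U)
    (hC' : C' ∈ componentsOf U) {y : M} (hy : y ∈ C) (hy' : y ∈ C') : C = C' :=
  (eq_connectedComponentIn_of_mem hC hy).trans (eq_connectedComponentIn_of_mem hC' hy').symm

/-- Two distinct components of `U` are disjoint. [folklore] -/
theorem disjoint_of_mem_componentsOf {U C C' : Set M} (hC : C ∈ componentsOf U)
    (hC' : C' ∈ componentsOf U) (hne : C ≠ C') : Disjoint C C' :=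
  disjoint_left.2 fun _ hy hy' => hne (eq_of_mem_componentsOf_of_mem hC hC' hy hy')

/-- A preconnected subset of `U` meeting a component lies in it. [folklore] -/
theorem subset_of_mem_componentsOf_of_isPreconnected {U C s : Set M} (hC : C ∈ componentsOf U)
    (hs : IsPreconnected s) (hsU : s ⊆ U) {y : M} (hy : y ∈ C) (hys : y ∈ s) : s ⊆ C := by
  rw [eq_connectedComponentIn_of_mem hC hy]
  exact hs.subset_connectedComponentIn hys hsU

/-- `U` is the union of its components. [folklore] -/
theorem sUnion_componentsOf (U : Set M) : ⋃₀ componentsOf U = U := by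
  apply Subset.antisymm
  · rintro y ⟨C, hC, hy⟩
    exact subset_of_mem_componentsOf hC hy
  · intro y hy
    exact ⟨_, connectedComponentIn_mem_componentsOf hy, mem_connectedComponentIn hy⟩

/-- **Components of an open set are open** (in a locally connected space, e.g. a manifold).
[folklore] -/
theorem isOpen_of_mem_componentsOf [LocallyConnectedSpace M] {U C : Set M} (hU : IsOpen U)
    (hC : C ∈ componentsOf U) : IsOpen C := by
  obtain ⟨x, -, rfl⟩ := mem_componentsOf_iff.1 hC
  exact hU.connectedComponentIn

/-- The union of the components of `U` other than `C` is open (for `U` open). [folklore] -/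
theorem isOpen_diff_of_mem_componentsOf [LocallyConnectedSpace M] {U C : Set M} (hU : IsOpen U)
    (hC : C ∈ componentsOf U) : IsOpen (U \ C) := by
  rw [isOpen_iff_mem_nhds]
  rintro y ⟨hyU, hyC⟩
  have hD := connectedComponentIn_mem_componentsOf (U := U) hyU
  refine Filter.mem_of_superset ((isOpen_of_mem_componentsOf hU hD).mem_nhds
    (mem_connectedComponentIn hyU)) fun z hz => ⟨connectedComponentIn_subset U y hz, fun hzC => ?_⟩
  exact hyC ((eq_of_mem_componentsOf_of_mem hC hD hzC hz) ▸ mem_connectedComponentIn hyU)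

/-- **Absorbing a component into the closed set**: if `N` is closed and `C` is a component of
`Nᶜ`, then `N ∪ C` is closed (its complement is the union of the other components). [folklore] -/
theorem isClosed_union_of_mem_componentsOf [LocallyConnectedSpace M] {N C : Set M}
    (hN : IsClosed N) (hC : C ∈ componentsOf Nᶜ) : IsClosed (N ∪ C) := by
  have : (N ∪ C)ᶜ = Nᶜ \ C := by ext x; simp
  rw [← isOpen_compl_iff, this]
  exact isOpen_diff_of_mem_componentsOf hN.isOpen_compl hC

/-- **The components after absorbing one of them**: the components of `(N ∪ C)ᶜ = Nᶜ ∖ C` are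
exactly the components of `Nᶜ` other than `C`. [folklore] -/
theorem componentsOf_compl_union_eq {N C : Set M} (hC : C ∈ componentsOf Nᶜ) :
    componentsOf (N ∪ C)ᶜ = componentsOf Nᶜ \ {C} := by
  have hNC : (N ∪ C)ᶜ = Nᶜ \ C := by ext x; simp
  -- the component in `Nᶜ ∖ C` of a point outside `C` is its component in `Nᶜ`
  have key : ∀ y ∈ Nᶜ \ C, connectedComponentIn (Nᶜ \ C) y = connectedComponentIn Nᶜ y := by
    rintro y ⟨hyN, hyC⟩
    apply Subset.antisymm (connectedComponentIn_mono y fun _ h => h.1)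
    refine isPreconnected_connectedComponentIn.subset_connectedComponentIn
      (mem_connectedComponentIn hyN) fun z hz => ⟨connectedComponentIn_subset _ _ hz, fun hzC => ?_⟩
    have hD := connectedComponentIn_mem_componentsOf (U := Nᶜ) hyN
    exact hyC ((eq_of_mem_componentsOf_of_mem hC hD hzC hz) ▸ mem_connectedComponentIn hyN)
  rw [hNC]
  ext D
  simp only [mem_componentsOf_iff, mem_sdiff, mem_singleton_iff]
  constructor
  · rintro ⟨y, hy, rfl⟩
    rw [key y hy]
    refine ⟨⟨y, hy.1, rfl⟩, fun h => hy.2 ?_⟩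
    rw [← h]
    exact mem_connectedComponentIn hy.1
  · rintro ⟨⟨y, hy, rfl⟩, hne⟩
    have hyC : y ∉ C := fun hyC =>
      hne (eq_of_mem_componentsOf_of_mem (connectedComponentIn_mem_componentsOf hy) hC
        (mem_connectedComponentIn hy) hyC)
    exact ⟨y, ⟨hy, hyC⟩, key y ⟨hy, hyC⟩⟩

/-- A component `C` of `Nᶜ` is disjoint from `N`. [folklore] -/
theorem disjoint_of_mem_componentsOf_compl {N C : Set M} (hC : C ∈ componentsOf Nᶜ) :
    Disjoint C N :=
  disjoint_left.2 fun _ hy hyN => subset_of_mem_componentsOf hC hy hyN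

end Components

/-! ### Shells of `ℝⁿ` are connected -/

section Shell

variable {E : Type*} [NormedAddCommGroup E] [NormedSpace ℝ E]

/-- **A shell `{a < ‖x‖ < b}` (`0 ≤ a`) of a real normed space of dimension `> 1` is connected**:
it is the image of the connected set `S(0,1) × (a, b)` under `(θ, t) ↦ t • θ`. [folklore] -/
theorem isConnected_shell (hE : 1 < Module.rank ℝ E) {a b : ℝ} (ha : 0 ≤ a) (hab : a < b) :
    IsConnected {x : E | a < ‖x‖ ∧ ‖x‖ < b} := by
  have hS : IsConnected (sphere (0 : E) 1 ×ˢ Ioo a b) :=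
    (isConnected_sphere hE 0 zero_le_one).prod (isConnected_Ioo hab)
  have himage : (fun p : E × ℝ => p.2 • p.1) '' (sphere (0 : E) 1 ×ˢ Ioo a b) =
      {x : E | a < ‖x‖ ∧ ‖x‖ < b} := by
    apply Subset.antisymm
    · rintro _ ⟨⟨θ, t⟩, ⟨hθ, ht⟩, rfl⟩
      have htpos : 0 < t := ha.trans_lt ht.1
      simp only [mem_setOf_eq, norm_smul, mem_sphere_zero_iff_norm.1 hθ, mul_one, Real.norm_eq_abs,
        abs_of_pos htpos]
      exact ht
    · rintro x ⟨h1, h2⟩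
      have hx : 0 < ‖x‖ := ha.trans_lt h1
      have hx0 : x ≠ 0 := norm_pos_iff.1 hx
      refine ⟨(‖x‖⁻¹ • x, ‖x‖), ⟨?_, h1, h2⟩, ?_⟩
      · rw [mem_sphere_zero_iff_norm, norm_smul, norm_inv, norm_norm, inv_mul_cancel₀ hx.ne']
      · simp only [smul_smul, mul_inv_cancel₀ hx.ne', one_smul]
  rw [← himage]
  exact hS.image _ (continuous_snd.smul continuous_fst).continuousOn

end Shell

/-! ### Ball pieces and their boundary spheres -/

section BallPiece

variable {M : Type} [TopologicalSpace M]

/-- Ball pieces are monotone in `N`. [folklore] -/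
theorem IsBallPiece.mono [ChartedSpace (EuclideanSpace ℝ (Fin 4)) M] {N N₁ C : Set M}
    (h : IsBallPiece N C) (hN : N ⊆ N₁) :
    IsBallPiece N₁ C := by
  obtain ⟨ι, hι, ho, hC, hN'⟩ := h
  exact ⟨ι, hι, ho, hC, hN'.trans hN⟩

omit [TopologicalSpace M] in
/-- For a ball piece `C ⊆ Nᶜ` with collar `ι`: `ι x ∈ N ↔ 1 ≤ ‖x‖`. [folklore] -/
theorem IsBallPiece.mem_iff_of_witness {N C : Set M} (hCN : Disjoint C N)
    {ι : EuclideanSpace ℝ (Fin 4) → M} (hC : ι '' ball 0 1 = C) (hN : ι '' (ball 0 1)ᶜ ⊆ N)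
    (x : EuclideanSpace ℝ (Fin 4)) : ι x ∈ N ↔ 1 ≤ ‖x‖ := by
  constructor
  · intro hx
    by_contra h
    have : ι x ∈ C := hC ▸ mem_image_of_mem ι (mem_ball_zero_iff.2 (not_le.1 h))
    exact hCN.le_bot ⟨this, hx⟩
  · intro hx
    exact hN (mem_image_of_mem ι (by simpa using hx))

omit [TopologicalSpace M] in
/-- For a ball piece `C ⊆ Nᶜ` with collar `ι`: `range ι ∩ Nᶜ = C`. [folklore] -/
theorem IsBallPiece.range_inter_compl_of_witness {N C : Set M} (hCN : Disjoint C N)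
    {ι : EuclideanSpace ℝ (Fin 4) → M} (hC : ι '' ball 0 1 = C) (hN : ι '' (ball 0 1)ᶜ ⊆ N) :
    range ι ∩ Nᶜ = C := by
  apply Subset.antisymm
  · rintro _ ⟨⟨x, rfl⟩, hxN⟩
    have hx : ‖x‖ < 1 := by
      by_contra h
      exact hxN ((IsBallPiece.mem_iff_of_witness hCN hC hN x).2 (not_lt.1 h))
    exact hC ▸ mem_image_of_mem ι (mem_ball_zero_iff.2 hx)
  · intro y hy
    obtain ⟨x, -, rfl⟩ := (hC.symm ▸ hy : y ∈ ι '' ball 0 1)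
    exact ⟨mem_range_self x, fun h => hCN.le_bot ⟨hy, h⟩⟩

/-- **The closure of a ball piece is the image of the closed ball** under its collar.
[folklore] -/
theorem IsBallPiece.closure_eq_of_witness [T2Space M] {C : Set M}
    {ι : EuclideanSpace ℝ (Fin 4) → M} (hι : Continuous ι) (hC : ι '' ball 0 1 = C) :
    closure C = ι '' closedBall 0 1 := by
  apply Subset.antisymm
  · rw [← hC]
    exact closure_minimal (image_mono ball_subset_closedBall)
      ((isCompact_closedBall (0 : EuclideanSpace ℝ (Fin 4)) 1).image hι).isClosed
  · rw [← hC, ← closure_ball (0 : EuclideanSpace ℝ (Fin 4)) one_ne_zero]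
    exact image_closure_subset_closure_image hι

/-- **The boundary sphere of a ball piece**: `closure C ∖ C = ι(S³)` for any collar `ι` of the
ball piece `C` (so this set does not depend on the collar). [folklore] -/
theorem IsBallPiece.closure_diff_eq_of_witness [T2Space M] {C : Set M}
    {ι : EuclideanSpace ℝ (Fin 4) → M} (hι : Continuous ι) (hinj : Injective ι)
    (hC : ι '' ball 0 1 = C) : closure C \ C = ι '' sphere 0 1 := by
  rw [IsBallPiece.closure_eq_of_witness hι hC, ← hC, ← image_sdiff hinj,
    closedBall_sdiff_ball]

/-- The boundary sphere of a ball piece `C ⊆ Nᶜ` lies in `N`. [folklore] -/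
theorem IsBallPiece.closure_diff_subset [T2Space M] [ChartedSpace (EuclideanSpace ℝ (Fin 4)) M]
    {N C : Set M} (h : IsBallPiece N C) (hCN : Disjoint C N) : closure C \ C ⊆ N := by
  obtain ⟨ι, hι, -, hC, hN⟩ := h
  rw [IsBallPiece.closure_diff_eq_of_witness hι.contMDiff.continuous hι.isEmbedding.injective hC]
  rintro _ ⟨x, hx, rfl⟩
  exact (IsBallPiece.mem_iff_of_witness hCN hC hN x).2 (mem_sphere_zero_iff_norm.1 hx).ge

/-- The outer collar `ι({1 < ‖x‖})` of a ball piece lies in the interior of `N`. [folklore] -/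
theorem IsBallPiece.image_subset_interior_of_witness {N : Set M}
    {ι : EuclideanSpace ℝ (Fin 4) → M} (ho : IsOpenMap ι) (hN : ι '' (ball 0 1)ᶜ ⊆ N) :
    ι '' {x | 1 < ‖x‖} ⊆ interior N :=
  interior_maximal ((image_mono fun x (hx : 1 < ‖x‖) => by
    simp only [mem_compl_iff, mem_ball_zero_iff, not_lt]; exact hx.le).trans hN)
    (ho _ (isOpen_lt continuous_const continuous_norm))

/-- The boundary sphere of a ball piece `C ⊆ Nᶜ` misses the interior of `N` (its points are
limits of points of `C`). [folklore] -/
theorem IsBallPiece.closure_diff_inter_interior {N C : Set M} (hCN : Disjoint C N) :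
    closure C \ C ∩ interior N = ∅ := by
  apply eq_empty_of_forall_notMem
  rintro y ⟨⟨hyc, -⟩, hyi⟩
  rw [_root_.mem_closure_iff] at hyc
  obtain ⟨z, hzi, hzC⟩ := hyc (interior N) isOpen_interior hyi
  exact hCN.le_bot ⟨hzC, interior_subset hzi⟩

/-- **Distinct ball pieces of `Nᶜ` have disjoint boundary spheres** (indeed a boundary point of
`C` has the open neighbourhood `range ι`, which meets `Nᶜ` only in `C`). Stated as: if the
boundary sphere of the ball piece `C` meets the closure of the component `C'`, then `C = C'`.
[folklore] -/
theorem IsBallPiece.eq_of_mem_closure [T2Space M] [ChartedSpace (EuclideanSpace ℝ (Fin 4)) M]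
    {N C C' : Set M} (hC : C ∈ componentsOf Nᶜ) (hC' : C' ∈ componentsOf Nᶜ)
    (h : IsBallPiece N C) {y : M} (hy : y ∈ closure C \ C) (hy' : y ∈ closure C') : C = C' := by
  obtain ⟨ι, hι, ho, hCe, hN⟩ := h
  have hCN := disjoint_of_mem_componentsOf_compl hC
  rw [IsBallPiece.closure_diff_eq_of_witness hι.contMDiff.continuous hι.isEmbedding.injective hCe]
    at hy
  obtain ⟨x, -, rfl⟩ := hy
  rw [_root_.mem_closure_iff] at hy'
  obtain ⟨z, ⟨w, rfl⟩, hzC'⟩ := hy' (range ι) ho (mem_range_self x)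
  have hzC : ι w ∈ C := by
    rw [← IsBallPiece.range_inter_compl_of_witness hCN hCe hN]
    exact ⟨mem_range_self w, fun hN' => subset_of_mem_componentsOf hC' hzC' hN'⟩
  exact eq_of_mem_componentsOf_of_mem hC hC' hzC hzC'

/-- **A collar carries a thin shell around its sphere into a single component.** Let `ι` be a
collar of a ball piece of `Nᶜ` (or any continuous map of `ℝ⁴`), `U ⊇ ι(S³)` open, and
`Φ : M → M'` continuous on `U` and mapping `U ∩ ι(𝔹⁴)` into `N'ᶜ`. Then for some `0 < δ ≤ 1/2`
the shell `ι({1 - δ < ‖x‖ < 1})` lies in `U` and is mapped by `Φ` into one component of `N'ᶜ`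
(shells of `ℝ⁴` are connected). [folklore] -/
theorem exists_mem_componentsOf_image_shell_subset {M' : Type*} [TopologicalSpace M']
    {ι : EuclideanSpace ℝ (Fin 4) → M} (hι : Continuous ι) {U : Set M} (hU : IsOpen U)
    (hSU : ι '' sphere 0 1 ⊆ U) {Φ : M → M'} (hΦ : ContinuousOn Φ U) {N' : Set M'}
    (hΦN : ∀ x : EuclideanSpace ℝ (Fin 4), ‖x‖ < 1 → ι x ∈ U → Φ (ι x) ∈ N'ᶜ) :
    ∃ δ : ℝ, 0 < δ ∧ δ ≤ 1 / 2 ∧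
      (∀ x : EuclideanSpace ℝ (Fin 4), 1 - δ < ‖x‖ → ‖x‖ < 1 + δ → ι x ∈ U) ∧
      ∃ C' ∈ componentsOf N'ᶜ,
        ∀ x : EuclideanSpace ℝ (Fin 4), 1 - δ < ‖x‖ → ‖x‖ < 1 → Φ (ι x) ∈ C' := by
  obtain ⟨δ, hδ, hδh, hδU⟩ :=
    Literature.Topology.FourManifolds.exists_twoSidedShell_subset (hU.preimage hι)
      (fun x hx => hSU (mem_image_of_mem ι hx))
  refine ⟨δ, hδ, hδh, fun x h1 h2 => hδU x h1 h2, ?_⟩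
  -- the thin inner shell is connected and mapped into `N'ᶜ`
  have hrank : 1 < Module.rank ℝ (EuclideanSpace ℝ (Fin 4)) := by
    rw [← Module.finrank_eq_rank, finrank_euclideanSpace_fin]
    norm_num
  have hconn : IsConnected {x : EuclideanSpace ℝ (Fin 4) | 1 - δ < ‖x‖ ∧ ‖x‖ < 1} :=
    isConnected_shell hrank (by linarith) (by linarith)
  have hsub : ∀ x : EuclideanSpace ℝ (Fin 4), 1 - δ < ‖x‖ → ‖x‖ < 1 → ι x ∈ U := fun x h1 h2 =>
    hδU x h1 (by linarith)
  have hcont : ContinuousOn (fun x => Φ (ι x)) {x : EuclideanSpace ℝ (Fin 4) | 1 - δ < ‖x‖ ∧ ‖x‖ < 1} :=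
    hΦ.comp hι.continuousOn fun x hx => hsub x hx.1 hx.2
  have himc : IsPreconnected ((fun x => Φ (ι x)) '' {x : EuclideanSpace ℝ (Fin 4) | 1 - δ < ‖x‖ ∧ ‖x‖ < 1}) :=
    hconn.isPreconnected.image _ hcont
  obtain ⟨x₀, hx₀⟩ := hconn.nonempty
  have hy₀ : Φ (ι x₀) ∈ N'ᶜ := hΦN x₀ hx₀.2 (hsub x₀ hx₀.1 hx₀.2)
  refine ⟨connectedComponentIn N'ᶜ (Φ (ι x₀)), connectedComponentIn_mem_componentsOf hy₀,
    fun x h1 h2 => ?_⟩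
  exact himc.subset_connectedComponentIn (mem_image_of_mem _ hx₀)
    (by rintro _ ⟨x, hx, rfl⟩; exact hΦN x hx.2 (hsub x hx.1 hx.2)) (mem_image_of_mem _ ⟨h1, h2⟩)

end BallPiece

end Literature.Geometry.Riemannian
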